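import Summits.Ventures.CertifiedManyBodySolver.Certificates.HubbardSquare_cellword_Kit
import Literature.MathematicalPhysics.QuantumLattice.HubbardTTPrimeDiagHopTransport
import HarnessLib

/-!
# Ventures/CertifiedManyBodySolver — Certificates/HubbardSquare_cellword_KitEdge.lean (hubbard-box-eng-2 g3, cell hubbard-fast)

HONEST FRAMING: transport bookkeeping of certified ground-state-energy bounds; not a superconductivity verdict; not a
pairing bound; no number is certified in this file — two GENERIC composition lemmas for census-CELL kernel words on an
EDGE STRIP `t′ ∈ [sₐ, s_b]` lying OUTSIDE the last census / extension column `s₁` (e.g. the NdNiO₂ object-E sliver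
`t′ ∈ [−0.46, −0.45]` beyond the `t′ = −9/20` extension column):
* `cell_column_lower` — two slab-uniform node floors `L₁, L₂` at `(s₁, U₁)`, `(s₁, U₂)` floor the whole column segment
  `U ∈ [U₁, U₂]` by `min L₁ L₂` (joint concavity in `(t′, U)`, `energyDensityTT'_ge_convexComb`);
* `cell_edge_strip_lower` — the same floor degraded by the KINEMATIC `t′`-Lipschitz constant `16/π² < 1621139/10⁶`
  times the distance to the column (`energyDensityTT'_sub_sixteen_div_pi_sq_mul_le`): `min L₁ L₂ − 1.621139·w ≤ e(s,U,n)`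
  whenever `|s − s₁| ≤ w`. Caps need no edge device (the tangent planes hold at every `t′`).
-/

noncomputable section

namespace Summit.Ventures.CertifiedManyBodySolver.Certificates

open Matrix Finset Filter Topology
open Literature.MathematicalPhysics.QuantumLattice
open Literature.MathematicalPhysics.QuantumLattice.ThermodynamicLimit
open Literature.Probability.LatticeModels
open scoped ComplexOrder ComplexConjugate Topology BigOperators

/-- `16/π² < 1.621139` (the engine's K-row constant, outward). [cite: LiebLoss1993, §8, Theorem 8.2] -/
private theorem sixteen_div_pi_sq_lt_Krow : 16 / Real.pi ^ 2 < (1621139/1000000 : ℝ) := by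
  have hπ : (3.14159265358979323846 : ℝ) < Real.pi := Real.pi_gt_d20
  have hpos : (0 : ℝ) < Real.pi ^ 2 := by positivity
  have hsq : (9.869604401 : ℝ) < Real.pi ^ 2 := by nlinarith
  rw [div_lt_iff₀ hpos]
  nlinarith

/-- **Column-segment floor.** Slab-uniform floors `L₁ ≤ e(s₁,U₁,·)`, `L₂ ≤ e(s₁,U₂,·)` at two nodes of ONE `t′`-column
(`0 ≤ U₁ < U₂`) give `min L₁ L₂ ≤ e(s₁,U,n)` for every `U ∈ [U₁, U₂]` and every `n` of the slab (concavity in `U`: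
`energyDensityTT'_ge_convexComb` with both points on the column). [cite: Israel1979, Thm. I.3.4] -/
theorem cell_column_lower {s₁ U₁ U₂ L₁ L₂ n₁ n₂ : ℝ} (hU₁ : 0 ≤ U₁) (hU : U₁ < U₂) (hn₁ : 0 ≤ n₁) (hn₂ : n₂ < 2)
    (h₁ : ∀ n ∈ Set.Icc n₁ n₂, L₁ ≤ energyDensityTT' 1 s₁ U₁ n)
    (h₂ : ∀ n ∈ Set.Icc n₁ n₂, L₂ ≤ energyDensityTT' 1 s₁ U₂ n)
    {U n : ℝ} (hU₁' : U₁ ≤ U) (hU₂' : U ≤ U₂) (hn : n ∈ Set.Icc n₁ n₂) :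
    min L₁ L₂ ≤ energyDensityTT' 1 s₁ U n := by
  have hn0 : 0 ≤ n := by linarith [hn.1]
  have hn2 : n < 2 := by linarith [hn.2]
  have hd : 0 < U₂ - U₁ := by linarith
  set a := (U₂ - U) / (U₂ - U₁) with ha
  set b := (U - U₁) / (U₂ - U₁) with hb
  have ha0 : 0 ≤ a := div_nonneg (by linarith) hd.le
  have hb0 : 0 ≤ b := div_nonneg (by linarith) hd.le
  have hab : a + b = 1 := by
    rw [ha, hb, ← add_div, div_eq_one_iff_eq hd.ne']
    ring
  have hc := energyDensityTT'_ge_convexComb 1 hn0 hn2 (s₁ := s₁) (s₂ := s₁) (U₁ := U₁) (U₂ := U₂)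
    hU₁ (by linarith) ha0 hb0 hab (h₁ n hn) (h₂ n hn)
  have e1 : a * s₁ + b * s₁ = s₁ := by rw [← add_mul, hab, one_mul]
  have e2 : a * U₁ + b * U₂ = U := by
    rw [ha, hb]
    field_simp
    ring
  rw [e1, e2] at hc
  have hm1 := mul_le_mul_of_nonneg_left (min_le_left L₁ L₂) ha0
  have hm2 := mul_le_mul_of_nonneg_left (min_le_right L₁ L₂) hb0
  have e3 : a * min L₁ L₂ + b * min L₁ L₂ = min L₁ L₂ := by rw [← add_mul, hab, one_mul]
  linarith

/-- **Edge-strip floor (kinematic `t′`-Lipschitz).** With the column-segment floor `min L₁ L₂ ≤ e(s₁,U,n)` on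
`U ∈ [U₁, U₂]` and `|s − s₁| ≤ w`: `min L₁ L₂ − (1621139/10⁶)·w ≤ e(s,U,n)` — the diagonal-hopping energy per site is at
most `16/π² < 1.621139` in absolute value (`energyDensityTT'_sub_sixteen_div_pi_sq_mul_le`), so a floor at `t′ = s₁`
degrades linearly in `|t′ − s₁|`. [cite: LiebLoss1993, §8, Theorem 8.2] -/
theorem cell_edge_strip_lower {s₁ U₁ U₂ L₁ L₂ n₁ n₂ w : ℝ} (hU₁ : 0 ≤ U₁) (hU : U₁ < U₂) (hn₁ : 0 ≤ n₁)
    (hn₂ : n₂ < 2)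
    (h₁ : ∀ n ∈ Set.Icc n₁ n₂, L₁ ≤ energyDensityTT' 1 s₁ U₁ n)
    (h₂ : ∀ n ∈ Set.Icc n₁ n₂, L₂ ≤ energyDensityTT' 1 s₁ U₂ n)
    {s U n : ℝ} (hw : |s - s₁| ≤ w) (hU₁' : U₁ ≤ U) (hU₂' : U ≤ U₂) (hn : n ∈ Set.Icc n₁ n₂) :
    min L₁ L₂ - 1621139/1000000 * w ≤ energyDensityTT' 1 s U n := by
  have hn0 : 0 ≤ n := by linarith [hn.1]
  have hn2 : n < 2 := by linarith [hn.2]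
  have hcol := cell_column_lower hU₁ hU hn₁ hn₂ h₁ h₂ hU₁' hU₂' hn
  have hU0 : 0 ≤ U := hU₁.trans hU₁'
  have hk := energyDensityTT'_sub_sixteen_div_pi_sq_mul_le 1 hU0 hn0 hn2 s₁ s
  have hw0 : 0 ≤ w := (abs_nonneg _).trans hw
  have hpi : 0 ≤ 16 / Real.pi ^ 2 := by positivity
  have h3 : 16 / Real.pi ^ 2 * |s - s₁| ≤ 1621139/1000000 * w :=
    (mul_le_mul_of_nonneg_left hw hpi).trans (mul_le_mul_of_nonneg_right sixteen_div_pi_sq_lt_Krow.le hw0)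
  linarith

end Summit.Ventures.CertifiedManyBodySolver.Certificates

end
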